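import Literature.MathematicalPhysics.QuantumFieldTheory.Balaban1983to89.Node00.Record13DatumKey
import Literature.MathematicalPhysics.QuantumFieldTheory.Balaban1983to89.Node00.Record13CoP

/-!
# NODE 00 (YM-PLAN Track A) — THE STAGE-13 DATUM ∕ RECORD KEYS RE-KEYED ON THE bg-FREE CORE PROVISOS `Stage13Params.Provisos₁₃Core` AT PRINT'S BACKGROUND FIELD:
# the datum `datumOfRecord₁₃CoP` of def-T's `Node00/Record13CoP` (RECORD 13, v1.5 `CoP` EDITION OF RECORD, director-ym №160 F7 ∕ №162 (y): print's 𝐓-weights ζ_j(Y)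
# WITHOUT the small-field cut, and the co-divergent-class minimiser ON ITS SUPPORT Ω₀) — `IsDatumOfRecord₁₃CCoP`
# (+ `.params ∕ .provisos`, `canon₁₃CoP`, `IsRateKey₁₃CoP`), the regime keys `IsDatumOfRecord₁₃CCoPOn ∕ IsRecordOfRecord₁₃CCoPOn ∕ canon₁₃CoPOn`, the CN keys at the guard of
# record `IsDatumOfRecord₁₃CCoPN ∕ IsRecordOfRecord₁₃CCoPN`; NO bridge from the ‴ ∕ ⁗ ∕ `SepMixed` ∕ `Co` ∕ `SepCo` keys (not statable — another datum), the v1.5 keys (`SepCoP`)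
# bridge INTO it

NODE 00 RECORD MODULE (cell `pub-ymgap`, seat `pub-ymgap-node00-def-RR-2` gen 12 = second reader ∕ key + instance side of the RATE-RECORD HOME, director-ym R141 (A);
dag-lead «datum-KEY twin leaf = RR-2 lineage, one declarer»).  THE `CoP` TWIN (v1.5 EDITION) of this seat's `Node00/Record13DatumKey` (the Stage-13 datum ∕ record keys
over `Stage13Params.Provisos₁₃`, v1.1 of def-T's `Node00/Record13`; «‴») — equivalently, the `Co ↦ CoP` image of this seat's v1.4 leaf `Node00/Record13DatumKeyCo` — RE-KEYED on
def-T's bg-FREE CORE proviso predicate `Stage13Params.Provisos₁₃Core` (v1.2 §9a: the displayed provisos of record WITHOUT the background-field row `bg`; NOT re-issued at v1.5 —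
token-identical, none of its rows names the 𝐓-weights or a background) AND on def-T's v1.5 datum `datumOfRecord₁₃CoP F N θ (h : θ.Provisos₁₃Core F N)` of `Node00/Record13CoP`
(FILE 23; director-ym LINE №160 F7 + LINE №162 «(y) FINAL: HOLD-ALL; rev 20 keys ONCE on v1.5 `CoP`»).  THE v1.5 EDITION, SAID ONCE: RECORD 13 re-generated, token for token
(def-T KEY-RULE-21 R1–R6 and its KEY-23 table), at TWO re-typed seeds — (𝐓) print's weights ζ_j(Y) of [III] (1.11) p.248 ∕ (3.40), the pinned residual's resummation INCLUDING the
P₀ ≠ ∅ terms and WITHOUT the small-field cut χ_reg (def-T F7-a `Node00/TkWeightsOfRecordP`: `zetaWtP`, `tkWeightsOfRecordP`; the cut weights of FILE 21 were ζ·χ_reg), and (U) the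
background field = the minimiser over [15]'s co-divergent class (director-ym №152 (β)) with the scale-0 clauses (1.7) ∕ (1.9) ∕ (7) RE-RANGED to print's support «Ω₀ ⊇ Ω₁», Ω₁ plus
one layer of M₁-cubes ([15] p.277 (1)–(3), p.278 (5); [III] p.255) instead of the whole torus (node00-def-R F7-b `Node00/LargeFieldBackgroundCoPOfRecord`: `regMSCoPOfRecord ∕
bgMSCoPOfRecord ∕ UbgMSCoPOfRecord ∕ regSuppPOfRecord`; def-T's `UbgOfRecord₁₃CoP`) — so the §2 form, the 𝐑-leaf, the Stage-5 residual `Stage13Params.toStage5₁₃CoP`, the core, the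
tower and the datum of RECORD 13 are def-T's, re-generated AT THOSE SEEDS; the pre-№160 siblings — v1.2's `datumOfRecord₁₃Core` (at `UbgOfRecord₁₃`) and v1.4's `datumOfRecord₁₃Co`
(FILE 21, at `UbgOfRecord₁₃Co` with the cut weights) — stay in the tree, keyed by the ‴ ∕ ⁗ ∕ `SepMixed` resp. `Co ∕ SepCo` key leaves of this seat, which STAND VERBATIM (their
landed storeys are settled helper leaves, director-ym №160 (5)).  WHY THIS KEY (plan g67 CORE-YES, dag-n22-e DESIGN-INPUT-CORE, director-ym №152 §4 «key ONCE, on Core», №162 (y)): the ≈ 30 rate-record ∕ spine-record CONSUMER storeys are bg-BLIND and proviso-FIELD-blind — the proviso proof enters ONLY as a binder type and inside the applied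
datum — so they key ONCE on `(hc : θ.Provisos₁₃Core F N)` ∕ `datumOfRecord₁₃CoP F N θ hc` and are applied at a v1.5 item's tuple `(θ, h : θ.Provisos₁₃SepCoP F N)` by `hc :=
h.toCore`, the datum agreeing by `rfl` (def-T's `datumOfRecord₁₃SepCoP_eq_coP`); a later located revision of the `bg` row over the SAME background then costs the consumer side NO
file.  The route's ITEM texts (rev 20) key on the proviso OF RECORD `Provisos₁₃SepCoP` (the item must SEE the `bg` row; def-T FILE 24T `Node00/Record13SepCoP`); the item-facing junction
sentences live in this seat's `Node00/Record13DatumKeySepCoP`, whose §8 bridges the v1.5-keyed classes INTO the classes below.  This module is the token map applied to `Node00/Record13DatumKey`: EVERY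
declaration of §1–§7 below is the v1.1-keyed declaration with `(h : θ.Provisos₁₃ F N) ↦ (h : θ.Provisos₁₃Core F N)`, `datumOfRecord₁₃ ↦ datumOfRecord₁₃CoP`, `θ.toStage5₁₃ ↦
θ.toStage5₁₃CoP`, `IsRecordOfRecord₁₃C… ↦ IsRecordOfRecord₁₃CCoP…` in its statement and proof, under the NAME RULE «def-T's token `CoP` at def-T's position» (KEY-RULE-21 R1 ∕ R2):
`IsDatumOfRecord₁₃C ↦ IsDatumOfRecord₁₃CCoP`, `IsDatumOfRecord₁₃COn ↦ IsDatumOfRecord₁₃CCoPOn`, `IsDatumOfRecord₁₃CN ↦ IsDatumOfRecord₁₃CCoPN`, `IsRecordOfRecord₁₃COn ∕ CN ↦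
IsRecordOfRecord₁₃CCoPOn ∕ CCoPN`, `canon₁₃ ↦ canon₁₃CoP`, `canon₁₃On ↦ canon₁₃CoPOn`, `IsRateKey₁₃ ↦ IsRateKey₁₃CoP`, the theorem stems likewise (`isDatumOfRecord₁₃CCoP_datumOfRecord₁₃CoP`,
`exists_keyed_canon₁₃CoP_iff`, `keyed_canon₁₃CoPOn_coherent`, `forall_isRecordOfRecord₁₃CCoPN_iff`, …) — equivalently, the ⁗ module `Node00/Record13DatumKeySep` with `CSep ↦ CCoP`,
`canon₁₃Sep ↦ canon₁₃CoP`, `IsRateKey₁₃Sep ↦ IsRateKey₁₃CoP`, `Provisos₁₃Sep ↦ Provisos₁₃Core`, `datumOfRecord₁₃Sep ↦ datumOfRecord₁₃CoP`; equivalently, the v1.4 leaf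
`Node00/Record13DatumKeyCo` with `Co ↦ CoP` at every key ∕ datum ∕ residual ∕ module token (its 106 declarations map onto the 106 below ONE FOR ONE, statement AND proof — checked byte
for byte against the landed file before filing).  KEYED FLAT on `datumOfRecord₁₃CoP`.  APPEND-ONLY:
a NEW leaf importing `Node00/Record13DatumKey` (the ‴ key: θ-level assignments and the guard of record, by name) and def-T's `Node00/Record13CoP` (hence, transitively, `Node00/Record13`
v1.2, `Node00/TkWeightsOfRecordP` and `Node00/LargeFieldBackgroundCoPOfRecord`); NOTHING landed is edited — the ‴, ⁗, `SepMixed`, `Co` and `SepCo` key modules stand VERBATIM (keys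
of the pre-№160 editions).  CONSUMED BY NAME from
def-T's `Node00/Record13` (v1.2 §9a): `Stage13Params.Provisos₁₃Core`; from def-T's `Node00/Record13CoP`: `datumOfRecord₁₃CoP`, `Stage13Params.toStage5₁₃CoP`, the RECORD PREDICATE
`IsRecordOfRecord₁₃CCoP F N D w` := `∃ θ (h : θ.Provisos₁₃Core F N), θ.Admissible F N ∧ D = datumOfRecord₁₃CoP F N θ h ∧ w.C = D.C ∧ (0 < w.γ ∧ w.γ ≤ θ.γ) ∧ w.L = θ.L ∧ ∀ P, w.up P =
upOfRecord₅C F N (θ.toStage5₁₃CoP F N) P` (clause order identical to `…C ∕ …CSep ∕ …CSepMixed`), `exists_world_isRecordOfRecord₁₃CCoP`, `exists_provisos_of_isRecordOfRecord₁₃CCoP`,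
`exists_isRecordOfRecord₅C_of_isRecordOfRecord₁₃CCoP`, the `rfl` ∕ read-off faces `βfun_ ∕ flow_g_ ∕ av_ ∕ isDatumOfRecord₀_datumOfRecord₁₃CoP`, `isPrintedAveraged_datumOfRecord₁₃CoP`;
REUSED BY NAME from `Node00/Record13DatumKey` (θ-level, proviso-free, background-free — NOT twinned): the residual-assignment types and lifts `RateAssignment₁₃ ∕ SpineAssignment₁₃`
(`.ofStageFree ∕ .of₁₁ ∕ .of₁₂ ∕ .toStageFree`, `rateAssignment₁₃OfStageFree ∕ Of₁₁ ∕ Of₁₂`, `spineAssignment₁₃OfStageFree ∕ Of₁₁ ∕ Of₁₂`) and the guard of record `unityNondeg₁₃ ∕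
unityNondeg₁₃_iff`; background-free θ-level tokens of record unchanged (`gOfRecord₁₃`, `betaOfRecord₁₃`, `Stage13Params.Admissible ∕ .ZtUnity ∕ .SlotsNondegenerate₁₃`).  The key
layer is PROVISO-FIELD-BLIND and BACKGROUND-BLIND (no declaration here projects a field of `Provisos₁₃Core` or reads `UbgOfRecord₁₃CoP`), which is why the re-key is a token map
and every proof term of §1–§7 is the v1.1 proof term.

WHY THIS OBJECT (as at v1.1 ∕ v1.2; said once more for the core reader).  The rate-record home and the spine-record home of clusters K4 ∕ K5 are read JOINTLY by the N19′
edge, so both are keyed to ONE parameter per datum: THE CANONICAL PARAMETER `h.params := Classical.choose h` of `h : IsDatumOfRecord₁₃CCoP F N D`, with `h.provisos :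
h.params.Provisos₁₃Core F N`, `h.admissible`, `h.eq_datumOfRecord₁₃CoP : D = datumOfRecord₁₃CoP F N h.params h.provisos`; every θ-level object of record then has ONE
datum-level instance per `(F, D, g₀, os)`, records keyed «`∃ θ hP, θ.Admissible F N ∧ D = datumOfRecord₁₃CoP F N θ hP ∧ S = canon₁₃CoP F N cr θ hP g₀ os`» are COHERENT
(`exists_keyed_canon₁₃CoP_iff`, `keyed_canon₁₃CoP_coherent`), and a consumer proving its node at EVERY admissible tuple with core provisos proves it at the datum
(`IsDatumOfRecord₁₃CCoP.forall_params`).  `isDatumOfRecord₁₃CCoP_iff_exists_world`: the datum class IS def-T's `IsRecordOfRecord₁₃CCoP` with the world forgotten;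
«`∃ D w, IsRecordOfRecord₁₃CCoP F N D w`» REDUCES HONESTLY to «one admissible Stage-13 tuple with every field of `Provisos₁₃Core` a theorem»
(`exists_isDatumOfRecord₁₃CCoP_iff_exists_params`) — INHABITATION IS NOT CLAIMED HERE.  `IsRateKey₁₃CoP F N D w θ` is `IsRecordOfRecord₁₃CCoP`'s body with θ EXPOSED
(`isRecordOfRecord₁₃CCoP_iff_exists_isRateKey₁₃CoP`, `Iff.rfl`).  THE REGIME KEYS (§4–§6): a reading that CONSUMES a regime `Rg : (F : T4Family) → Stage13Params F N → Prop`
quantifies over `IsDatumOfRecord₁₃CCoPOn F N Rg D` ∕ `IsRecordOfRecord₁₃CCoPOn F N Rg D w` (canonical parameter IN the regime, `h.regime`; junction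
`forall_isRecordOfRecord₁₃CCoPOn_iff`; `canon₁₃CoPOn Rg` with COHERENCE).  §7 instantiates the CN keys at the guard of record `unityNondeg₁₃ N F θ := θ.ZtUnity F N ∧
θ.SlotsNondegenerate₁₃ F N` with the literal faces `isDatumOfRecord₁₃CCoPN_iff`, `exists_isDatumOfRecord₁₃CCoPN_iff_exists_params` and `forall_isRecordOfRecord₁₃CCoPN_iff`
(= a core-keyed ∀-storey's binder prefix `∀ (θ) (hc : θ.Provisos₁₃Core F N), (θ.ZtUnity F N ∧ θ.SlotsNondegenerate₁₃ F N) → θ.Admissible F N → … (datumOfRecord₁₃CoP F N θ hc)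
…`).  At the trivial regime everything is the CCore key again (`isDatumOfRecord₁₃CCoPOn_true_iff`, `isRecordOfRecord₁₃CCoPOn_true_iff`).  NOMINAL STRENGTH, SAID ONCE: a
core-keyed ∀-storey quantifies over MORE parameters than the item of record (every admissible tuple satisfying the nine bg-free rows, not only those with the background-field
row) — harmless for the θ-generic rate ∕ spine storeys (none reads `bg`), and it is NOT the item's obligation: the item-facing junction stays at the proviso of record.

NO §8 HERE — WHY NO BRIDGE ENTERS THIS KEY FROM THE OLDER KEYS.  `IsDatumOfRecord₁₃C F N D` (‴), `IsDatumOfRecord₁₃CSep F N D` (⁗) and `IsDatumOfRecord₁₃CSepMixed F N D` pin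
`D` to a datum generated at `UbgOfRecord₁₃` with the cut weights (v1.1 ∕ v1.2 ∕ v1.3, or v1.2's `datumOfRecord₁₃Core` by `rfl`); `IsDatumOfRecord₁₃CCo F N D` ∕ `…CSepCo` (v1.4) pin `D`
to `datumOfRecord₁₃Co`, generated at `UbgOfRecord₁₃Co` with the cut weights; `IsDatumOfRecord₁₃CCoP F N D` pins `D` to `datumOfRecord₁₃CoP`, generated at `UbgOfRecord₁₃CoP` with
print's uncut weights — data of record that no `rfl` and no lemma in the tree relate (the backgrounds would agree at most through [15] Thm 1's uniqueness of the minimiser modulo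
gauge, which is NOT asserted anywhere, and the v1.5 densities differ from every older one by the dropped cut outright); so no implication between the older classes and the classes
below is statable AT THE SAME DATUM, in either direction, and none is filed.  The ONLY bridge into this key is from the v1.5-keyed classes (`Node00/Record13DatumKeySepCoP` §8:
`IsRateKey₁₃SepCoP.toCoP`, `IsDatumOfRecord₁₃CSepCoP[On∕N].toCoP`, `IsRecordOfRecord₁₃CSepCoP(On∕N).toCoP` along def-T's `Provisos₁₃SepCoP.toCore`, the datum by `rfl`); a CoP-keyed
∀-storey is applied at a v1.5 item's tuple `(θ, h)` as `… θ h.toCore …` — NO converse (`Provisos₁₃Core → Provisos₁₃SepCoP` would assert a background-field bound from nothing), and the canonical parameters `h.params ∕ h.toCoP.params` of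
one datum under the two keys are NOT related by any lemma (two choices).

WHAT IS NOT HERE.  NO edit of any landed key module or consumer; NO bridge from or to the ‴ ∕ ⁗ ∕ `SepMixed` ∕ `Co` ∕ `SepCo` keys (see above); NO `CoP → SepCoP` bridge; NO `₁₂ ↔ ₁₃` key
bridge; NO reading of any proviso row or of the background; NO inhabitant of any key; the θ-level assignments and the guard of record are NOT re-declared (imported by name);
def-T's re-based record predicate and its faces are NOT re-declared (consumed by name from `Node00/Record13CoP`); NO `Provisos₁₃Core` inhabitant and NO record is claimed to exist.

HONEST FRAMING.  Definitions of record + kernel bookkeeping (`Classical.choose`, `rfl`, `dite`, ∃-repackaging); NOTHING of Bałaban's is asserted; NO inhabitant of any key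
is claimed (the record's inhabitation item is OPEN); no node is discharged; counts unmoved (COUNT-NEUTRAL); one finite four-torus programme at fixed `ε` — NOT the
continuum limit on ℝ⁴, NOT infinite volume, NOT OS, NOT a mass gap, NOT the Clay problem.  No `sorry` ∕ `axiom` ∕ `opaque` ∕ `instance` ∕ `notation`.
[Balaban1989LargeFieldII] = Commun. Math. Phys. **122** (1989) 355–392; [III] = [Balaban1988Convergent] = Commun. Math. Phys. **119** (1988) 243–285 ((1.11) p.248: print's ζ_j(Y);
p.255: the support); [Balaban1988RG2Cluster] = Commun. Math. Phys. **116** (1988) 1–22; [Balaban1987RG1] = Commun. Math. Phys. **109** (1987) 249–301; [15] = [Balaban1985Variational] =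
Commun. Math. Phys. **102** (1985) 277–309, (1)–(3), (5)–(8) pp.277–280 and Thm 1 (the domains Ω_j, the regular ∕ co-divergent classes and the minimiser); [6] = [Balaban1985RegularSpaces]
= Commun. Math. Phys. **99** (1985) 75–102 — [15] and [6] cited for orientation only, nothing of them asserted (ERRATUM to the v1.4 leaf's header, which printed «[15] =
[Balaban1985RegularSpaces] = CMP 102»: the CMP-102 paper is [Balaban1985Variational]; docstring only, nothing keyed on it).
-/

noncomputable section

namespace Literature.MathematicalPhysics.QuantumFieldTheory.Balaban1983to89.Node00

open T4Continuum AveragingRT T4FiniteEpsInhabited FlowStep FlowStepRuns DagBinding T4DatumAssembly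

/-! ## §1. «`D` is a datum of record, Stage 13» and its CANONICAL parameter -/

section DatumKey

variable (F : T4Family) (N : ℕ) [NeZero N]

/-- **«`D` is a datum of record, Stage 13 (C-class)»**: SOME admissible Stage-13 parameter tuple satisfying its displayed provisos has `D` as its datum of record — the
datum-level shadow of `IsRecordOfRecord₁₃CCoP` (the world forgotten; `isDatumOfRecord₁₃CCoP_iff_exists_world`). [cite: Balaban1989LargeFieldII, Thm 1 + (0.1) pp.355–356; Balaban1988Convergent, Thms 1–2 pp.262–263 (objects of record; bookkeeping)] -/
def IsDatumOfRecord₁₃CCoP (D : FiniteEpsData F (SU N)) : Prop :=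
  ∃ (θ : Stage13Params F N) (h : θ.Provisos₁₃Core F N), θ.Admissible F N ∧ D = datumOfRecord₁₃CoP F N θ h

/-- Every admissible Stage-13 parameter tuple with provisos yields a datum of record. [cite: Balaban1989LargeFieldII, Thm 1 + (0.1) pp.355–356 (bookkeeping)] -/
theorem isDatumOfRecord₁₃CCoP_datumOfRecord₁₃CoP (θ : Stage13Params F N) (h : θ.Provisos₁₃Core F N) (hθ : θ.Admissible F N) :
    IsDatumOfRecord₁₃CCoP F N (datumOfRecord₁₃CoP F N θ h) :=
  ⟨θ, h, hθ, rfl⟩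

/-- **K0′ READS THE SAME AT THE DATUM**: some datum of record exists at `(F, N)` iff some Stage-13 record pair `(D, w)` exists (the body of the route's K0′
`Record12Inhabited` at `N`). [cite: Balaban1989LargeFieldII, Thm 1 + (0.1) pp.355–356 (bookkeeping)] -/
theorem exists_isDatumOfRecord₁₃CCoP_iff_exists_record :
    (∃ D : FiniteEpsData F (SU N), IsDatumOfRecord₁₃CCoP F N D) ↔ ∃ (D : FiniteEpsData F (SU N)) (w : WorldP), IsRecordOfRecord₁₃CCoP F N D w := by
  constructor
  · rintro ⟨_, θ, hP, hθ, rfl⟩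
    obtain ⟨w, hw, -⟩ := exists_world_isRecordOfRecord₁₃CCoP F N θ hP hθ ⟨hθ.toStage9.gamma_pos, le_rfl⟩
    exact ⟨_, w, hw⟩
  · rintro ⟨D, w, hw⟩
    exact ⟨D, exists_provisos_of_isRecordOfRecord₁₃CCoP hw⟩

/-- **THE HONEST REDUCTION OF K0′**: some datum of record exists at `(F, N)` iff SOME Stage-13 parameter tuple is admissible and satisfies every displayed proviso —
«exhibit ONE admissible `Stage13Params` with EVERY proviso field a theorem» (the K0′ components); inhabitation is NOT claimed in this module.
[cite: Balaban1988Convergent, (2.7) p.255, (2.21) p.258, (2.28) p.259, (3.16) p.268, (3.21) p.269; Balaban1987RG1, (1.12)–(1.15) p.262 (hypothesis dictionary; bookkeeping)] -/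
theorem exists_isDatumOfRecord₁₃CCoP_iff_exists_params :
    (∃ D : FiniteEpsData F (SU N), IsDatumOfRecord₁₃CCoP F N D) ↔ ∃ θ : Stage13Params F N, θ.Provisos₁₃Core F N ∧ θ.Admissible F N := by
  constructor
  · rintro ⟨_, θ, hP, hθ, -⟩
    exact ⟨θ, hP, hθ⟩
  · rintro ⟨θ, hP, hθ⟩
    exact ⟨_, isDatumOfRecord₁₃CCoP_datumOfRecord₁₃CoP F N θ hP hθ⟩

variable {F N}
variable {D : FiniteEpsData F (SU N)} {w : WorldP}

/-- A Stage-13 record's datum is a Stage-13 datum of record. [cite: Balaban1989LargeFieldII, Thm 1 p.355 (bookkeeping)] -/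
theorem isDatumOfRecord₁₃CCoP_of_isRecordOfRecord₁₃CCoP (h : IsRecordOfRecord₁₃CCoP F N D w) : IsDatumOfRecord₁₃CCoP F N D :=
  exists_provisos_of_isRecordOfRecord₁₃CCoP h

/-- **DATUM OF RECORD ⟺ RECORD AT SOME WORLD.** [cite: Balaban1989LargeFieldII, Thm 1 + (0.1) pp.355–356 (bookkeeping)] -/
theorem isDatumOfRecord₁₃CCoP_iff_exists_world : IsDatumOfRecord₁₃CCoP F N D ↔ ∃ w : WorldP, IsRecordOfRecord₁₃CCoP F N D w := by
  constructor
  · rintro ⟨θ, hP, hθ, rfl⟩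
    obtain ⟨w, hw, -⟩ := exists_world_isRecordOfRecord₁₃CCoP F N θ hP hθ ⟨hθ.toStage9.gamma_pos, le_rfl⟩
    exact ⟨w, hw⟩
  · rintro ⟨w, hw⟩
    exact isDatumOfRecord₁₃CCoP_of_isRecordOfRecord₁₃CCoP hw

/-- **THE CANONICAL STAGE-13 PARAMETER OF A DATUM OF RECORD** (choice) — the ONE key both carrier records of clusters K4 ∕ K5 are read at.
[cite: Balaban1989LargeFieldII, Thm 1 + (0.1) pp.355–356 (bookkeeping)] -/
def IsDatumOfRecord₁₃CCoP.params (h : IsDatumOfRecord₁₃CCoP F N D) : Stage13Params F N :=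
  Classical.choose h

/-- Its provisos. [cite: Balaban1988Convergent, (2.7) p.255, (2.21) p.258, (2.35) p.261 (bookkeeping)] -/
theorem IsDatumOfRecord₁₃CCoP.provisos (h : IsDatumOfRecord₁₃CCoP F N D) : h.params.Provisos₁₃Core F N :=
  (Classical.choose_spec h).fst

/-- Its admissibility. [cite: Balaban1987RG1, (1.12) p.262; Balaban1988Convergent, (2.10) p.256 (bookkeeping)] -/
theorem IsDatumOfRecord₁₃CCoP.admissible (h : IsDatumOfRecord₁₃CCoP F N D) : h.params.Admissible F N :=
  (Classical.choose_spec h).snd.1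

/-- **The datum IS the datum of record of its canonical parameter.** [cite: Balaban1989LargeFieldII, Thm 1 p.355 (bookkeeping)] -/
theorem IsDatumOfRecord₁₃CCoP.eq_datumOfRecord₁₃CoP (h : IsDatumOfRecord₁₃CCoP F N D) : D = datumOfRecord₁₃CoP F N h.params h.provisos :=
  (Classical.choose_spec h).snd.2

/-- The canonical parameter's coupling window is positive. [cite: Balaban1987RG1, (0.21) p.256 (bookkeeping)] -/
theorem IsDatumOfRecord₁₃CCoP.gamma_pos (h : IsDatumOfRecord₁₃CCoP F N D) : 0 < h.params.γ :=
  h.admissible.toStage9.gamma_pos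

/-- … and lies inside `]0, 1[` (the Stage-12 sign `γ < 1` of the tuple's Stage-12 admissibility). [cite: Balaban1988Convergent, (2.28) p.259 (bookkeeping)] -/
theorem IsDatumOfRecord₁₃CCoP.gamma_lt_one (h : IsDatumOfRecord₁₃CCoP F N D) : h.params.γ < 1 :=
  h.admissible.toStage12.pos₁₂.2.2.2.2

/-- **WHAT A CONSUMER PROVES ⟹ WHAT THE INSTANCE CARRIES**: a property of the objects of record established at EVERY admissible Stage-13 parameter tuple with provisos
holds at the canonical parameter of every datum of record. [cite: Balaban1989LargeFieldII, Thm 1 p.355 (bookkeeping)] -/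
theorem IsDatumOfRecord₁₃CCoP.forall_params {P : (D : FiniteEpsData F (SU N)) → (θ : Stage13Params F N) → θ.Provisos₁₃Core F N → Prop}
    (hP : ∀ (θ : Stage13Params F N) (hθ : θ.Provisos₁₃Core F N), θ.Admissible F N → P (datumOfRecord₁₃CoP F N θ hθ) θ hθ) (h : IsDatumOfRecord₁₃CCoP F N D) :
    P D h.params h.provisos := by
  have := hP h.params h.provisos h.admissible
  rwa [← h.eq_datumOfRecord₁₃CoP] at this

/-- **WORLD COMPANION IN `₁₃C` AT ANY WINDOW BELOW THE CANONICAL ONE**: for `0 < γw ≤ h.params.γ` some world makes `(D, w)` a Stage-13 record with `w.γ = γw` — what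
the N17 home-keying binder («`RRec … R → ∃ w, IsRecordOfRecord₁₃CCoP F N D w ∧ R.u3.γ = w.γ`») consumes once `R.u3.γ` is pinned in that range.
[cite: Balaban1989LargeFieldII, Thm 1 + (0.1) pp.355–356 (bookkeeping)] -/
theorem IsDatumOfRecord₁₃CCoP.exists_world (h : IsDatumOfRecord₁₃CCoP F N D) {γw : ℝ} (hγw : 0 < γw ∧ γw ≤ h.params.γ) :
    ∃ w : WorldP, IsRecordOfRecord₁₃CCoP F N D w ∧ w.γ = γw := by
  obtain ⟨w, hw, hγ⟩ := exists_world_isRecordOfRecord₁₃CCoP F N h.params h.provisos h.admissible hγw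
  exact ⟨w, h.eq_datumOfRecord₁₃CoP ▸ hw, hγ⟩

/-- … in particular at the canonical window `h.params.γ` itself. [cite: Balaban1989LargeFieldII, Thm 1 + (0.1) pp.355–356 (bookkeeping)] -/
theorem IsDatumOfRecord₁₃CCoP.exists_world_gamma (h : IsDatumOfRecord₁₃CCoP F N D) :
    ∃ w : WorldP, IsRecordOfRecord₁₃CCoP F N D w ∧ w.γ = h.params.γ :=
  h.exists_world ⟨h.gamma_pos, le_rfl⟩

/-- **THE DATUM's β-FUNCTIONS ARE THE STAGE-13 β OF RECORD AT THE CANONICAL PARAMETER** (def-T's `βfun_datumOfRecord₁₃CoP`, `rfl` there; `betaOfRecord₁₃ F N θ` over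
`Stage13Params` is def-T's reducible name for the β of record re-based on the canonical-version transport and the (2.9)-species small-field function — NOT `betaOfRecord₁₀` of Stages 10–12: the histories of record differ, and there is
NO ₁₂ ↔ ₁₃ key bridge in this module) — what the (D4) read-out binders and node N17 read off `D`.
[cite: Balaban1987RG1, (1.20)–(1.22) p.264 (bookkeeping)] -/
theorem IsDatumOfRecord₁₃CCoP.βfun_eq_betaOfRecord₁₃ (h : IsDatumOfRecord₁₃CCoP F N D) : D.βfun = betaOfRecord₁₃ F N h.params := by
  have := βfun_datumOfRecord₁₃CoP F N h.params h.provisos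
  rwa [← h.eq_datumOfRecord₁₃CoP] at this

/-- The datum's coupling flow of the run `p` IS the Stage-13 generated history of record of the canonical parameter (def-T's `flow_g_datumOfRecord₁₃CoP`).
[cite: Balaban1987RG1, (0.17)–(0.20) pp.255–256 (bookkeeping)] -/
theorem IsDatumOfRecord₁₃CCoP.flow_g (h : IsDatumOfRecord₁₃CCoP F N D) (p : B12.RunParams) :
    (D.C p).flow.g = gOfRecord₁₃ F N h.params p := by
  have := flow_g_datumOfRecord₁₃CoP F N h.params h.provisos p
  rwa [← h.eq_datumOfRecord₁₃CoP] at this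

/-- The datum's averaging maps ARE the averaging maps of record. [cite: Balaban1987RG1, (0.4) p.253 (bookkeeping)] -/
theorem IsDatumOfRecord₁₃CCoP.av_eq (h : IsDatumOfRecord₁₃CCoP F N D) : D.av = avOfRecord F N := by
  have := av_datumOfRecord₁₃CoP F N h.params h.provisos
  rwa [← h.eq_datumOfRecord₁₃CoP] at this

/-- A Stage-13 datum of record is a datum of record, Stage 0 (binder B1 ∕ node N23's reading). [cite: Balaban1987RG1, (0.3)–(0.4) p.253 (bookkeeping)] -/
theorem IsDatumOfRecord₁₃CCoP.isDatumOfRecord₀ (h : IsDatumOfRecord₁₃CCoP F N D) : IsDatumOfRecord₀ F N D := by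
  rw [h.eq_datumOfRecord₁₃CoP]
  exact isDatumOfRecord₀_datumOfRecord₁₃CoP F N h.params h.provisos

/-- N23 · binder B1 at every Stage-13 datum of record. [cite: Balaban1987RG1, (0.4) p.253] -/
theorem IsDatumOfRecord₁₃CCoP.isPrintedAveraged (h : IsDatumOfRecord₁₃CCoP F N D) : D.IsPrintedAveraged := by
  rw [h.eq_datumOfRecord₁₃CoP]
  exact isPrintedAveraged_datumOfRecord₁₃CoP F N h.params h.provisos

/-- **THE ₅C SHADOW AT THE CANONICAL PARAMETER**: a Stage-13 datum of record is refined by a Stage-5 C-bound record at some world (def-T's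
`exists_isRecordOfRecord₅C_of_isRecordOfRecord₁₃CCoP` through the world companion) — for consumers keyed at ₅C. [cite: Balaban1989LargeFieldII, Thm 1 + (0.1) pp.355–356 (bookkeeping)] -/
theorem IsDatumOfRecord₁₃CCoP.exists_isRecordOfRecord₅C (h : IsDatumOfRecord₁₃CCoP F N D) :
    ∃ (D₅ : FiniteEpsData F (SU N)) (w : WorldP), IsRecordOfRecord₅C F N D₅ w ∧ D₅.C = D.C ∧ (∀ K g₀ k, D₅.dens K g₀ k = D.dens K g₀ k) ∧
      D₅.βfun = D.βfun ∧ D₅.av = D.av := by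
  obtain ⟨w, hw, -⟩ := h.exists_world_gamma
  obtain ⟨D₅, h₅⟩ := exists_isRecordOfRecord₅C_of_isRecordOfRecord₁₃CCoP hw
  exact ⟨D₅, w, h₅⟩

end DatumKey

/-! ## §2. Canonicalised readings — COHERENCE for records keyed «`∃ θ hP, θ.Admissible F N ∧ D = datumOfRecord₁₃CoP F N θ hP ∧ S = cr F θ hP …`»

Reading an existentially keyed record through `canon₁₃CoP f` makes the admitted bundle a function of the DATUM: `canon₁₃CoP f θ hP = f h.params h.provisos` whenever
`datumOfRecord₁₃CoP F N θ hP = D` and `h : IsDatumOfRecord₁₃CCoP F N D` (`canon₁₃CoP_eq_of_eq`), so two records keyed independently but read through `canon₁₃CoP` admit, at the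
same `(F, D, g₀, os)`, bundles read at the SAME parameter (`exists_keyed_canon₁₃CoP_iff` turns either key into «`∃ h : IsDatumOfRecord₁₃CCoP F N D, Φ (f h.params
h.provisos)`»).  Off the datum-of-record class `canon₁₃CoP f = f`. -/
section Canon

variable (F : T4Family) (N : ℕ) [NeZero N] {α : Sort*}

/-- **CANONICALISED READING**: read `f` at the canonical parameter of the datum `datumOfRecord₁₃CoP F N θ hP` when that datum is of record (admissible), else at
`(θ, hP)` itself.  Kernel bookkeeping (`Classical.dec`, `dite`). [cite: Balaban1989LargeFieldII, Thm 1 + (0.1) pp.355–356 (bookkeeping)] -/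
def canon₁₃CoP (f : (θ : Stage13Params F N) → θ.Provisos₁₃Core F N → α) (θ : Stage13Params F N) (hP : θ.Provisos₁₃Core F N) : α := by
  classical
  exact if h : IsDatumOfRecord₁₃CCoP F N (datumOfRecord₁₃CoP F N θ hP) then f h.params h.provisos else f θ hP

variable {F N}

/-- The canonical parameter depends on the datum only: transport of the key along `D = D'` does not change `.params` (proof irrelevance + `subst`).
[cite: Balaban1989LargeFieldII, Thm 1 + (0.1) pp.355–356 (bookkeeping)] -/
theorem IsDatumOfRecord₁₃CCoP.params_congr {D D' : FiniteEpsData F (SU N)} (h : IsDatumOfRecord₁₃CCoP F N D) (h' : IsDatumOfRecord₁₃CCoP F N D') (e : D = D') :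
    h.params = h'.params := by
  subst e
  rfl

/-- **`canon₁₃CoP f θ hP = f h.params h.provisos`** whenever `(θ, hP)` realises a datum of record `D` with key `h`. [cite: Balaban1989LargeFieldII, Thm 1 + (0.1) pp.355–356 (bookkeeping)] -/
theorem canon₁₃CoP_eq_of_eq {f : (θ : Stage13Params F N) → θ.Provisos₁₃Core F N → α} {D : FiniteEpsData F (SU N)} (h : IsDatumOfRecord₁₃CCoP F N D)
    (θ : Stage13Params F N) (hP : θ.Provisos₁₃Core F N) (e : D = datumOfRecord₁₃CoP F N θ hP) :
    canon₁₃CoP F N f θ hP = f h.params h.provisos := by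
  subst e
  unfold canon₁₃CoP
  rw [dif_pos h]

/-- At the canonical parameter itself `canon₁₃CoP f` reads `f`. [cite: Balaban1989LargeFieldII, Thm 1 + (0.1) pp.355–356 (bookkeeping)] -/
theorem canon₁₃CoP_params {f : (θ : Stage13Params F N) → θ.Provisos₁₃Core F N → α} {D : FiniteEpsData F (SU N)} (h : IsDatumOfRecord₁₃CCoP F N D) :
    canon₁₃CoP F N f h.params h.provisos = f h.params h.provisos :=
  canon₁₃CoP_eq_of_eq h h.params h.provisos h.eq_datumOfRecord₁₃CoP

/-- At an admissible tuple with provisos, `canon₁₃CoP f` reads `f` at the canonical parameter of ITS datum. [cite: Balaban1989LargeFieldII, Thm 1 + (0.1) pp.355–356 (bookkeeping)] -/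
theorem canon₁₃CoP_eq_of_admissible {f : (θ : Stage13Params F N) → θ.Provisos₁₃Core F N → α} (θ : Stage13Params F N) (hP : θ.Provisos₁₃Core F N) (hθ : θ.Admissible F N) :
    canon₁₃CoP F N f θ hP = f (isDatumOfRecord₁₃CCoP_datumOfRecord₁₃CoP F N θ hP hθ).params (isDatumOfRecord₁₃CCoP_datumOfRecord₁₃CoP F N θ hP hθ).provisos :=
  canon₁₃CoP_eq_of_eq _ θ hP rfl

/-- Off the datum-of-record class nothing is canonicalised. [cite: Balaban1989LargeFieldII, Thm 1 + (0.1) pp.355–356 (bookkeeping)] -/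
theorem canon₁₃CoP_eq_self_of_not {f : (θ : Stage13Params F N) → θ.Provisos₁₃Core F N → α} (θ : Stage13Params F N) (hP : θ.Provisos₁₃Core F N)
    (hn : ¬ IsDatumOfRecord₁₃CCoP F N (datumOfRecord₁₃CoP F N θ hP)) : canon₁₃CoP F N f θ hP = f θ hP := by
  unfold canon₁₃CoP
  rw [dif_neg hn]

/-- **THE KEYED-RECORD FACE**: an existentially keyed record («some admissible `θ` with provisos realises `D` and the bundle reads `canon₁₃CoP f` there») IS the
datum-keyed record («the bundle reads `f` at the canonical parameter of `D`») — for every property `Φ` of the reading (e.g. `Φ x := S = x g₀ os`).  This is the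
sentence that makes (T-SPINE)'s and (T-RATE)'s Stage-13 records COHERENT. [cite: Balaban1989LargeFieldII, Thm 1 + (0.1) pp.355–356 (bookkeeping)] -/
theorem exists_keyed_canon₁₃CoP_iff {f : (θ : Stage13Params F N) → θ.Provisos₁₃Core F N → α} {D : FiniteEpsData F (SU N)} (Φ : α → Prop) :
    (∃ (θ : Stage13Params F N) (hP : θ.Provisos₁₃Core F N), θ.Admissible F N ∧ D = datumOfRecord₁₃CoP F N θ hP ∧ Φ (canon₁₃CoP F N f θ hP)) ↔
      ∃ h : IsDatumOfRecord₁₃CCoP F N D, Φ (f h.params h.provisos) := by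
  constructor
  · rintro ⟨θ, hP, hθ, e, hΦ⟩
    have h : IsDatumOfRecord₁₃CCoP F N D := ⟨θ, hP, hθ, e⟩
    refine ⟨h, ?_⟩
    rwa [canon₁₃CoP_eq_of_eq (f := f) h θ hP e] at hΦ
  · rintro ⟨h, hΦ⟩
    refine ⟨h.params, h.provisos, h.admissible, h.eq_datumOfRecord₁₃CoP, ?_⟩
    rwa [canon₁₃CoP_params (f := f) h]

/-- **COHERENCE**: two existentially keyed records read through `canon₁₃CoP` admit, at the same datum, readings AT THE SAME PARAMETER.
[cite: Balaban1989LargeFieldII, Thm 1 + (0.1) pp.355–356 (bookkeeping)] -/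
theorem keyed_canon₁₃CoP_coherent {β : Sort*} {f : (θ : Stage13Params F N) → θ.Provisos₁₃Core F N → α} {g : (θ : Stage13Params F N) → θ.Provisos₁₃Core F N → β}
    {D : FiniteEpsData F (SU N)} (Φ : α → Prop) (Ψ : β → Prop)
    (hΦ : ∃ (θ : Stage13Params F N) (hP : θ.Provisos₁₃Core F N), θ.Admissible F N ∧ D = datumOfRecord₁₃CoP F N θ hP ∧ Φ (canon₁₃CoP F N f θ hP))
    (hΨ : ∃ (θ : Stage13Params F N) (hP : θ.Provisos₁₃Core F N), θ.Admissible F N ∧ D = datumOfRecord₁₃CoP F N θ hP ∧ Ψ (canon₁₃CoP F N g θ hP)) :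
    ∃ h : IsDatumOfRecord₁₃CCoP F N D, Φ (f h.params h.provisos) ∧ Ψ (g h.params h.provisos) := by
  obtain ⟨h, h₁⟩ := (exists_keyed_canon₁₃CoP_iff Φ).1 hΦ
  obtain ⟨h', h₂⟩ := (exists_keyed_canon₁₃CoP_iff Ψ).1 hΨ
  exact ⟨h, h₁, h₂⟩

end Canon

/-! ## §3. The θ-exposed Stage-13 record key `IsRateKey₁₃CoP` and the residual ASSIGNMENTS of the rate-record home at Stage 13 (`RateAssignment₁₃` ∕ `SpineAssignment₁₃` over
`Stage13Params`, with the one-token lifts `.ofStage12` ∕ `.ofStage9` of the Stage-12 ∕ Stage-9-typed assignments; RR-1's object containers BY NAME) -/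

section Key

variable (F : T4Family) (N : ℕ) [NeZero N]

/-- **«(D, w) is the Stage-13 record WITH PARAMETERS θ»**: the body of `IsRecordOfRecord₁₃CCoP F N D w` with the Stage-13 parameter tuple EXPOSED — θ is admissible and
satisfies its displayed provisos, its datum of record IS `D`, and the world `w` is bound to the construction with a window `0 < w.γ ≤ θ.γ`, Bałaban's block size and
the C-binding of record over the Stage-13 view. [cite: Balaban1989LargeFieldII, Thm 1 + (0.1) pp.355–356; Balaban1987RG1, (0.24)–(0.25) p.257 (objects of record; bookkeeping)] -/
def IsRateKey₁₃CoP (D : FiniteEpsData F (SU N)) (w : WorldP) (θ : Stage13Params F N) : Prop :=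
  ∃ h : θ.Provisos₁₃Core F N, θ.Admissible F N ∧ D = datumOfRecord₁₃CoP F N θ h ∧ w.C = D.C ∧ (0 < w.γ ∧ w.γ ≤ θ.γ) ∧
    w.L = (θ.L : ℝ) ∧ ∀ P : B12.RunParams, w.up P = upOfRecord₅C F N (θ.toStage5₁₃CoP F N) P

/-- **A Stage-13 record IS a keyed record for SOME θ, and conversely** (`Iff.rfl`: the key is `IsRecordOfRecord₁₃CCoP`'s body). [cite: Balaban1989LargeFieldII, Thm 1 + (0.1) pp.355–356 (bookkeeping)] -/
theorem isRecordOfRecord₁₃CCoP_iff_exists_isRateKey₁₃CoP (D : FiniteEpsData F (SU N)) (w : WorldP) :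
    IsRecordOfRecord₁₃CCoP F N D w ↔ ∃ θ : Stage13Params F N, IsRateKey₁₃CoP F N D w θ := Iff.rfl

/-- **Pointed form of the key** at the datum of record. [cite: Balaban1989LargeFieldII, Thm 1 + (0.1) pp.355–356 (bookkeeping)] -/
theorem isRateKey₁₃CoP_of_eq (θ : Stage13Params F N) (h : θ.Provisos₁₃Core F N) (hθ : θ.Admissible F N) (w : WorldP)
    (hC : w.C = (datumOfRecord₁₃CoP F N θ h).C) (hγ : 0 < w.γ ∧ w.γ ≤ θ.γ) (hL : w.L = (θ.L : ℝ))
    (hup : ∀ P, w.up P = upOfRecord₅C F N (θ.toStage5₁₃CoP F N) P) :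
    IsRateKey₁₃CoP F N (datumOfRecord₁₃CoP F N θ h) w θ :=
  ⟨h, hθ, rfl, hC, hγ, hL, hup⟩

/-- **Every admissible θ satisfying its provisos is keyed at some world with any window `0 < γw ≤ θ.γ`** — inhabitation of the keyed class is Stage 13's exactly.
[cite: Balaban1989LargeFieldII, Thm 1 + (0.1) pp.355–356 (bookkeeping)] -/
theorem exists_world_isRateKey₁₃CoP (θ : Stage13Params F N) (h : θ.Provisos₁₃Core F N) (hθ : θ.Admissible F N) {γw : ℝ} (hγw : 0 < γw ∧ γw ≤ θ.γ) :
    ∃ w : WorldP, IsRateKey₁₃CoP F N (datumOfRecord₁₃CoP F N θ h) w θ ∧ w.γ = γw := by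
  obtain ⟨w₀⟩ := nonempty_worldP
  exact ⟨{ w₀ with
      C := (datumOfRecord₁₃CoP F N θ h).C, γ := γw, L := (θ.L : ℝ), one_lt_L := by exact_mod_cast θ.hL.2,
      up := fun P => upOfRecord₅C F N (θ.toStage5₁₃CoP F N) P },
    ⟨h, hθ, rfl, rfl, hγw, rfl, fun _ => rfl⟩, rfl⟩

variable {F N}
variable {D : FiniteEpsData F (SU N)} {w : WorldP} {θ : Stage13Params F N}

/-- A keyed record is a Stage-13 record. [cite: Balaban1989LargeFieldII, Thm 1 + (0.1) pp.355–356 (bookkeeping)] -/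
theorem IsRateKey₁₃CoP.isRecordOfRecord₁₃CCoP (hk : IsRateKey₁₃CoP F N D w θ) : IsRecordOfRecord₁₃CCoP F N D w := ⟨θ, hk⟩

/-- … hence its datum is a Stage-13 datum of record. [cite: Balaban1989LargeFieldII, Thm 1 p.355 (bookkeeping)] -/
theorem IsRateKey₁₃CoP.isDatumOfRecord₁₃CCoP (hk : IsRateKey₁₃CoP F N D w θ) : IsDatumOfRecord₁₃CCoP F N D :=
  isDatumOfRecord₁₃CCoP_of_isRecordOfRecord₁₃CCoP hk.isRecordOfRecord₁₃CCoP

/-- The key CERTIFIES θ's provisos and admissibility and realises `D` as θ's datum of record. [cite: Balaban1989LargeFieldI, (0.3)–(0.4) p.176 (bookkeeping)] -/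
theorem IsRateKey₁₃CoP.exists_provisos (hk : IsRateKey₁₃CoP F N D w θ) : ∃ h : θ.Provisos₁₃Core F N, θ.Admissible F N ∧ D = datumOfRecord₁₃CoP F N θ h := by
  obtain ⟨h, hθ, hD, -⟩ := hk
  exact ⟨h, hθ, hD⟩

/-- The key's θ is admissible. [cite: Balaban1987RG1, (1.20)–(1.21) p.264 (hypothesis dictionary; bookkeeping)] -/
theorem IsRateKey₁₃CoP.admissible (hk : IsRateKey₁₃CoP F N D w θ) : θ.Admissible F N := by
  obtain ⟨-, hθ, -⟩ := hk
  exact hθ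

/-- The world's window is positive. [cite: Balaban1987RG1, Thm 1 p.259 (bookkeeping)] -/
theorem IsRateKey₁₃CoP.gamma_pos (hk : IsRateKey₁₃CoP F N D w θ) : 0 < w.γ := by
  obtain ⟨-, -, -, -, hγ, -⟩ := hk
  exact hγ.1

/-- The world's window sits inside θ's coupling window: `w.γ ≤ θ.γ`. [cite: Balaban1987RG1, Thm 1 p.259 (bookkeeping)] -/
theorem IsRateKey₁₃CoP.gamma_le (hk : IsRateKey₁₃CoP F N D w θ) : w.γ ≤ θ.γ := by
  obtain ⟨-, -, -, -, hγ, -⟩ := hk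
  exact hγ.2

/-- The world reads θ's block factor. [cite: Balaban1987RG1, (0.1) p.251 (bookkeeping)] -/
theorem IsRateKey₁₃CoP.L_eq (hk : IsRateKey₁₃CoP F N D w θ) : w.L = (θ.L : ℝ) := by
  obtain ⟨-, -, -, -, -, hL, -⟩ := hk
  exact hL

/-- The world is bound to the datum's construction. [cite: Balaban1989LargeFieldII, Thm 1 + (0.1) pp.355–356 (bookkeeping)] -/
theorem IsRateKey₁₃CoP.construction_eq (hk : IsRateKey₁₃CoP F N D w θ) : w.C = D.C := by
  obtain ⟨-, -, -, hC, -⟩ := hk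
  exact hC

/-- The upstream block of the world is the C-binding of record at the Stage-13 view. [cite: Balaban1989LargeFieldII, Thm 1 + (0.1) pp.355–356 (bookkeeping)] -/
theorem IsRateKey₁₃CoP.up_eq (hk : IsRateKey₁₃CoP F N D w θ) (P : B12.RunParams) : w.up P = upOfRecord₅C F N (θ.toStage5₁₃CoP F N) P := by
  obtain ⟨-, -, -, -, -, -, hup⟩ := hk
  exact hup P

end Key


/-! ## §4. «`D` is a datum of record, Stage 13, realised IN THE REGIME `Rg`» and its canonical parameter in the regime -/

section DatumKeyOn

variable (F : T4Family) (N : ℕ) [NeZero N]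

/-- **«`D` is a datum of record, Stage 13, realised in the regime `Rg`»**: SOME admissible Stage-13 parameter tuple IN `Rg` satisfying its displayed provisos has `D` as its datum
of record — the common key prefix of the regime-restricted carrier homes (the Stage-13 re-keys of `YMDAG.UVSplit.RRec₁₂On 𝔯 Rg` ∕ `SRec₁₂On cr Rg`).  At `Rg := ⊤` it is the C key (`isDatumOfRecord₁₃CCoPOn_true_iff`).
[cite: Balaban1989LargeFieldII, Thm 1 + (0.1) pp.355–356; Balaban1988Convergent, Thms 1–2 pp.262–263 (objects of record; bookkeeping)] -/
def IsDatumOfRecord₁₃CCoPOn (Rg : (F : T4Family) → Stage13Params F N → Prop) (D : FiniteEpsData F (SU N)) : Prop :=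
  ∃ (θ : Stage13Params F N) (h : θ.Provisos₁₃Core F N), Rg F θ ∧ θ.Admissible F N ∧ D = datumOfRecord₁₃CoP F N θ h

variable (Rg : (F : T4Family) → Stage13Params F N → Prop)

/-- Unfolding (`Iff.rfl`). [cite: Balaban1989LargeFieldII, Thm 1 + (0.1) pp.355–356 (bookkeeping)] -/
theorem isDatumOfRecord₁₃CCoPOn_iff (D : FiniteEpsData F (SU N)) :
    IsDatumOfRecord₁₃CCoPOn F N Rg D ↔ ∃ (θ : Stage13Params F N) (h : θ.Provisos₁₃Core F N), Rg F θ ∧ θ.Admissible F N ∧ D = datumOfRecord₁₃CoP F N θ h :=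
  Iff.rfl

/-- Every admissible Stage-13 parameter tuple in the regime with provisos yields a datum of record in the regime. [cite: Balaban1989LargeFieldII, Thm 1 + (0.1) pp.355–356 (bookkeeping)] -/
theorem isDatumOfRecord₁₃CCoPOn_datumOfRecord₁₃CoP (θ : Stage13Params F N) (h : θ.Provisos₁₃Core F N) (hRg : Rg F θ) (hθ : θ.Admissible F N) :
    IsDatumOfRecord₁₃CCoPOn F N Rg (datumOfRecord₁₃CoP F N θ h) :=
  ⟨θ, h, hRg, hθ, rfl⟩

/-- **THE HONEST REDUCTION, IN THE REGIME**: some datum of record in `Rg` exists at `(F, N)` iff SOME Stage-13 parameter tuple satisfies every displayed proviso, lies in `Rg` and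
is admissible; inhabitation is NOT claimed in this module. [cite: Balaban1988Convergent, (2.7) p.255, (2.21) p.258, (3.16)–(3.22) pp.268–269; Balaban1987RG1, (1.12)–(1.15) p.262 (hypothesis dictionary; bookkeeping)] -/
theorem exists_isDatumOfRecord₁₃CCoPOn_iff_exists_params :
    (∃ D : FiniteEpsData F (SU N), IsDatumOfRecord₁₃CCoPOn F N Rg D) ↔ ∃ θ : Stage13Params F N, θ.Provisos₁₃Core F N ∧ Rg F θ ∧ θ.Admissible F N := by
  constructor
  · rintro ⟨_, θ, hP, hRg, hθ, -⟩
    exact ⟨θ, hP, hRg, hθ⟩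
  · rintro ⟨θ, hP, hRg, hθ⟩
    exact ⟨_, isDatumOfRecord₁₃CCoPOn_datumOfRecord₁₃CoP F N Rg θ hP hRg hθ⟩

/-- **A PROPERTY OF EVERY DATUM OF RECORD IN THE REGIME ⟺ THE θ-KEYED SENTENCE GUARDED BY `Rg`** (datum level). [cite: Balaban1989LargeFieldII, Thm 1 + (0.1) pp.355–356 (bookkeeping)] -/
theorem forall_isDatumOfRecord₁₃CCoPOn_iff (P : FiniteEpsData F (SU N) → Prop) :
    (∀ D : FiniteEpsData F (SU N), IsDatumOfRecord₁₃CCoPOn F N Rg D → P D) ↔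
      ∀ (θ : Stage13Params F N) (h : θ.Provisos₁₃Core F N), Rg F θ → θ.Admissible F N → P (datumOfRecord₁₃CoP F N θ h) := by
  constructor
  · intro hall θ h hRg hθ
    exact hall _ (isDatumOfRecord₁₃CCoPOn_datumOfRecord₁₃CoP F N Rg θ h hRg hθ)
  · rintro hall D ⟨θ, h, hRg, hθ, rfl⟩
    exact hall θ h hRg hθ

variable {F N Rg}
variable {D : FiniteEpsData F (SU N)}

/-- The regime forgotten: a datum of record in `Rg` is a datum of record (C key). [cite: Balaban1989LargeFieldII, Thm 1 p.355 (bookkeeping)] -/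
theorem IsDatumOfRecord₁₃CCoPOn.toC (h : IsDatumOfRecord₁₃CCoPOn F N Rg D) : IsDatumOfRecord₁₃CCoP F N D := by
  obtain ⟨θ, hP, -, hθ, hD⟩ := h
  exact ⟨θ, hP, hθ, hD⟩

/-- Monotone in the regime. [cite: Balaban1989LargeFieldII, Thm 1 p.355 (bookkeeping)] -/
theorem IsDatumOfRecord₁₃CCoPOn.mono {Rg' : (F : T4Family) → Stage13Params F N → Prop} (hle : ∀ (F : T4Family) (θ : Stage13Params F N), Rg F θ → Rg' F θ)
    (h : IsDatumOfRecord₁₃CCoPOn F N Rg D) : IsDatumOfRecord₁₃CCoPOn F N Rg' D := by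
  obtain ⟨θ, hP, hRg, hθ, hD⟩ := h
  exact ⟨θ, hP, hle F θ hRg, hθ, hD⟩

/-- At the trivial regime the key IS the C key. [cite: Balaban1989LargeFieldII, Thm 1 p.355 (bookkeeping)] -/
theorem isDatumOfRecord₁₃CCoPOn_true_iff : IsDatumOfRecord₁₃CCoPOn F N (fun _ _ => True) D ↔ IsDatumOfRecord₁₃CCoP F N D :=
  ⟨fun h => h.toC, fun ⟨θ, hP, hθ, hD⟩ => ⟨θ, hP, trivial, hθ, hD⟩⟩

/-- A datum of record whose C-CANONICAL parameter lies in the regime is a datum of record in the regime (companion of the (T-RATE) home's `rRec₁₂On_of_regime_params`, re-keyed).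
[cite: Balaban1989LargeFieldII, Thm 1 p.355 (bookkeeping)] -/
theorem IsDatumOfRecord₁₃CCoP.isDatumOfRecord₁₃CCoPOn_of_regime_params (h : IsDatumOfRecord₁₃CCoP F N D) (hRg : Rg F h.params) : IsDatumOfRecord₁₃CCoPOn F N Rg D :=
  ⟨h.params, h.provisos, hRg, h.admissible, h.eq_datumOfRecord₁₃CoP⟩

/-- **THE CANONICAL STAGE-13 PARAMETER OF A DATUM OF RECORD IN THE REGIME** (choice).  HONEST: it need not equal the C-canonical parameter `h.toC.params` of the same datum
(two choices over two existentials); the regime reaches THIS parameter (`.regime`), never `IsDatumOfRecord₁₃CCoP.params`. [cite: Balaban1989LargeFieldII, Thm 1 + (0.1) pp.355–356 (bookkeeping)] -/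
def IsDatumOfRecord₁₃CCoPOn.params (h : IsDatumOfRecord₁₃CCoPOn F N Rg D) : Stage13Params F N :=
  Classical.choose h

/-- Its provisos. [cite: Balaban1988Convergent, (2.7) p.255, (2.21) p.258, (2.35) p.261 (bookkeeping)] -/
theorem IsDatumOfRecord₁₃CCoPOn.provisos (h : IsDatumOfRecord₁₃CCoPOn F N Rg D) : h.params.Provisos₁₃Core F N :=
  (Classical.choose_spec h).fst

/-- **It lies IN THE REGIME.** [cite: Balaban1988Convergent, (3.16)–(3.22) pp.268–269 (bookkeeping)] -/
theorem IsDatumOfRecord₁₃CCoPOn.regime (h : IsDatumOfRecord₁₃CCoPOn F N Rg D) : Rg F h.params :=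
  (Classical.choose_spec h).snd.1

/-- Its admissibility. [cite: Balaban1987RG1, (1.12) p.262; Balaban1988Convergent, (2.10) p.256 (bookkeeping)] -/
theorem IsDatumOfRecord₁₃CCoPOn.admissible (h : IsDatumOfRecord₁₃CCoPOn F N Rg D) : h.params.Admissible F N :=
  (Classical.choose_spec h).snd.2.1

/-- **The datum IS the datum of record of its canonical parameter in the regime.** [cite: Balaban1989LargeFieldII, Thm 1 p.355 (bookkeeping)] -/
theorem IsDatumOfRecord₁₃CCoPOn.eq_datumOfRecord₁₃CoP (h : IsDatumOfRecord₁₃CCoPOn F N Rg D) : D = datumOfRecord₁₃CoP F N h.params h.provisos :=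
  (Classical.choose_spec h).snd.2.2

/-- The canonical parameter realises a C-datum key of `D` (pointed form; its `.params` is NOT asserted to be `h.params`). [cite: Balaban1989LargeFieldII, Thm 1 p.355 (bookkeeping)] -/
theorem IsDatumOfRecord₁₃CCoPOn.isDatumOfRecord₁₃CCoP_params (h : IsDatumOfRecord₁₃CCoPOn F N Rg D) :
    IsDatumOfRecord₁₃CCoP F N (datumOfRecord₁₃CoP F N h.params h.provisos) :=
  isDatumOfRecord₁₃CCoP_datumOfRecord₁₃CoP F N h.params h.provisos h.admissible

/-- The canonical parameter's coupling window is positive. [cite: Balaban1987RG1, (0.21) p.256 (bookkeeping)] -/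
theorem IsDatumOfRecord₁₃CCoPOn.gamma_pos (h : IsDatumOfRecord₁₃CCoPOn F N Rg D) : 0 < h.params.γ :=
  h.admissible.toStage9.gamma_pos

/-- … and lies inside `]0, 1[`. [cite: Balaban1988Convergent, (2.28) p.259 (bookkeeping)] -/
theorem IsDatumOfRecord₁₃CCoPOn.gamma_lt_one (h : IsDatumOfRecord₁₃CCoPOn F N Rg D) : h.params.γ < 1 :=
  h.admissible.toStage12.pos₁₂.2.2.2.2

/-- The canonical parameter in the regime depends on the datum only. [cite: Balaban1989LargeFieldII, Thm 1 + (0.1) pp.355–356 (bookkeeping)] -/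
theorem IsDatumOfRecord₁₃CCoPOn.params_congr {D' : FiniteEpsData F (SU N)} (h : IsDatumOfRecord₁₃CCoPOn F N Rg D) (h' : IsDatumOfRecord₁₃CCoPOn F N Rg D') (e : D = D') :
    h.params = h'.params := by
  subst e
  rfl

/-- **WHAT A CONSUMER PROVES IN THE REGIME ⟹ WHAT THE INSTANCE CARRIES**: a property of the objects of record established at EVERY admissible Stage-13 parameter tuple IN `Rg` with
provisos holds at the canonical parameter in the regime of every datum of record in the regime — the regime is AVAILABLE as a hypothesis. [cite: Balaban1989LargeFieldII, Thm 1 p.355 (bookkeeping)] -/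
theorem IsDatumOfRecord₁₃CCoPOn.forall_params {P : (D : FiniteEpsData F (SU N)) → (θ : Stage13Params F N) → θ.Provisos₁₃Core F N → Prop}
    (hP : ∀ (θ : Stage13Params F N) (hθ : θ.Provisos₁₃Core F N), Rg F θ → θ.Admissible F N → P (datumOfRecord₁₃CoP F N θ hθ) θ hθ) (h : IsDatumOfRecord₁₃CCoPOn F N Rg D) :
    P D h.params h.provisos := by
  have := hP h.params h.provisos h.regime h.admissible
  rwa [← h.eq_datumOfRecord₁₃CoP] at this

/-- The datum's β-functions are the Stage-13 β of record at the canonical parameter. [cite: Balaban1987RG1, (1.20)–(1.22) p.264 (bookkeeping)] -/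
theorem IsDatumOfRecord₁₃CCoPOn.βfun_eq_betaOfRecord₁₃ (h : IsDatumOfRecord₁₃CCoPOn F N Rg D) : D.βfun = betaOfRecord₁₃ F N h.params := by
  have := βfun_datumOfRecord₁₃CoP F N h.params h.provisos
  rwa [← h.eq_datumOfRecord₁₃CoP] at this

/-- The datum's coupling flow of the run `p` IS the Stage-13 generated history of record of the canonical parameter. [cite: Balaban1987RG1, (0.17)–(0.20) pp.255–256 (bookkeeping)] -/
theorem IsDatumOfRecord₁₃CCoPOn.flow_g (h : IsDatumOfRecord₁₃CCoPOn F N Rg D) (p : B12.RunParams) :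
    (D.C p).flow.g = gOfRecord₁₃ F N h.params p := by
  have := flow_g_datumOfRecord₁₃CoP F N h.params h.provisos p
  rwa [← h.eq_datumOfRecord₁₃CoP] at this

/-- A datum of record in the regime is a datum of record, Stage 0. [cite: Balaban1987RG1, (0.3)–(0.4) p.253 (bookkeeping)] -/
theorem IsDatumOfRecord₁₃CCoPOn.isDatumOfRecord₀ (h : IsDatumOfRecord₁₃CCoPOn F N Rg D) : IsDatumOfRecord₀ F N D :=
  h.toC.isDatumOfRecord₀


end DatumKeyOn

/-! ## §5. «`(D, w)` is a Stage-13 record realised IN THE REGIME `Rg`»; world companions; the θ-keyed guarded junction -/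

section RecordKeyOn

variable (F : T4Family) (N : ℕ) [NeZero N]

/-- **«`(D, w)` is a Stage-13 record (C-class) realised in the regime `Rg`»**: `IsRecordOfRecord₁₃CCoP F N D w`'s body (the θ-exposed key `IsRateKey₁₃CoP`) with the parameter IN
`Rg` — the regime-restricted record class a guarded composer quantifies over (`Spine`, `S_R00x`, `S_N27x` at `fun F D w => IsRecordOfRecord₁₃CCoPOn F N Rg D w`).  At `Rg := ⊤` it is
`IsRecordOfRecord₁₃CCoP` (`isRecordOfRecord₁₃CCoPOn_true_iff`). [cite: Balaban1989LargeFieldII, Thm 1 + (0.1) pp.355–356; Balaban1987RG1, (0.24)–(0.25) p.257 (objects of record; bookkeeping)] -/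
def IsRecordOfRecord₁₃CCoPOn (Rg : (F : T4Family) → Stage13Params F N → Prop) (D : FiniteEpsData F (SU N)) (w : WorldP) : Prop :=
  ∃ θ : Stage13Params F N, Rg F θ ∧ IsRateKey₁₃CoP F N D w θ

variable (Rg : (F : T4Family) → Stage13Params F N → Prop)

/-- Unfolding (`Iff.rfl`). [cite: Balaban1989LargeFieldII, Thm 1 + (0.1) pp.355–356 (bookkeeping)] -/
theorem isRecordOfRecord₁₃CCoPOn_iff (D : FiniteEpsData F (SU N)) (w : WorldP) :
    IsRecordOfRecord₁₃CCoPOn F N Rg D w ↔ ∃ θ : Stage13Params F N, Rg F θ ∧ IsRateKey₁₃CoP F N D w θ :=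
  Iff.rfl

/-- **Every admissible θ in the regime with provisos is a record in the regime at some world with any window `0 < γw ≤ θ.γ`.** [cite: Balaban1989LargeFieldII, Thm 1 + (0.1) pp.355–356 (bookkeeping)] -/
theorem exists_world_isRecordOfRecord₁₃CCoPOn (θ : Stage13Params F N) (h : θ.Provisos₁₃Core F N) (hRg : Rg F θ) (hθ : θ.Admissible F N) {γw : ℝ}
    (hγw : 0 < γw ∧ γw ≤ θ.γ) : ∃ w : WorldP, IsRecordOfRecord₁₃CCoPOn F N Rg (datumOfRecord₁₃CoP F N θ h) w ∧ w.γ = γw := by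
  obtain ⟨w, hk, hγ⟩ := exists_world_isRateKey₁₃CoP F N θ h hθ hγw
  exact ⟨w, ⟨θ, hRg, hk⟩, hγ⟩

/-- Some datum of record in the regime exists iff some record in the regime exists. [cite: Balaban1989LargeFieldII, Thm 1 + (0.1) pp.355–356 (bookkeeping)] -/
theorem exists_isDatumOfRecord₁₃CCoPOn_iff_exists_record :
    (∃ D : FiniteEpsData F (SU N), IsDatumOfRecord₁₃CCoPOn F N Rg D) ↔ ∃ (D : FiniteEpsData F (SU N)) (w : WorldP), IsRecordOfRecord₁₃CCoPOn F N Rg D w := by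
  constructor
  · rintro ⟨_, θ, hP, hRg, hθ, rfl⟩
    obtain ⟨w, hw, -⟩ := exists_world_isRecordOfRecord₁₃CCoPOn F N Rg θ hP hRg hθ ⟨hθ.toStage9.gamma_pos, le_rfl⟩
    exact ⟨_, w, hw⟩
  · rintro ⟨D, w, θ, hRg, hk⟩
    obtain ⟨hP, hθ, hD⟩ := hk.exists_provisos
    exact ⟨D, θ, hP, hRg, hθ, hD⟩

/-- **A WORLD-BLIND PROPERTY AT EVERY RECORD IN THE REGIME ⟺ THE θ-KEYED SENTENCE GUARDED BY `Rg`** — the junction between a composer's conclusion over the regime-restricted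
record class (e.g. `YMDAG.UVSplit.Spine` at `IsRecordOfRecord₁₃CCoPOn F N Rg`) and an item text «`∀ θ (h : θ.Provisos₁₃Core F N), Rg F θ → θ.Admissible F N → P (datumOfRecord₁₃CoP F N θ h)`».
[cite: Balaban1989LargeFieldII, Thm 1 + (0.1) pp.355–356 (bookkeeping)] -/
theorem forall_isRecordOfRecord₁₃CCoPOn_iff (P : FiniteEpsData F (SU N) → Prop) :
    (∀ (D : FiniteEpsData F (SU N)) (w : WorldP), IsRecordOfRecord₁₃CCoPOn F N Rg D w → P D) ↔
      ∀ (θ : Stage13Params F N) (h : θ.Provisos₁₃Core F N), Rg F θ → θ.Admissible F N → P (datumOfRecord₁₃CoP F N θ h) := by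
  constructor
  · intro hall θ h hRg hθ
    obtain ⟨w, hw, -⟩ := exists_world_isRecordOfRecord₁₃CCoPOn F N Rg θ h hRg hθ ⟨hθ.toStage9.gamma_pos, le_rfl⟩
    exact hall _ w hw
  · rintro hall D w ⟨θ, hRg, hk⟩
    obtain ⟨h, hθ, rfl⟩ := hk.exists_provisos
    exact hall θ h hRg hθ

variable {F N Rg}
variable {D : FiniteEpsData F (SU N)} {w : WorldP}

/-- The regime forgotten: a record in the regime is a Stage-13 record. [cite: Balaban1989LargeFieldII, Thm 1 p.355 (bookkeeping)] -/
theorem IsRecordOfRecord₁₃CCoPOn.isRecordOfRecord₁₃CCoP (h : IsRecordOfRecord₁₃CCoPOn F N Rg D w) : IsRecordOfRecord₁₃CCoP F N D w := by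
  obtain ⟨θ, -, hk⟩ := h
  exact hk.isRecordOfRecord₁₃CCoP

/-- Its datum is a datum of record in the regime. [cite: Balaban1989LargeFieldII, Thm 1 p.355 (bookkeeping)] -/
theorem IsRecordOfRecord₁₃CCoPOn.isDatumOfRecord₁₃CCoPOn (h : IsRecordOfRecord₁₃CCoPOn F N Rg D w) : IsDatumOfRecord₁₃CCoPOn F N Rg D := by
  obtain ⟨θ, hRg, hk⟩ := h
  obtain ⟨hP, hθ, hD⟩ := hk.exists_provisos
  exact ⟨θ, hP, hRg, hθ, hD⟩

/-- **THE TUPLE IN THE REGIME BEHIND A RECORD IN THE REGIME** — exactly the hypothesis shape of the (T-RATE) home's `s_R00x_rRec₁₂On_of_regime` (to be re-keyed at ₁₃) («every record of `Rec` comes with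
an admissible tuple with provisos in the regime realising `D`»): ONE application. [cite: Balaban1989LargeFieldII, Thm 1 + (0.1) pp.355–356 (bookkeeping)] -/
theorem IsRecordOfRecord₁₃CCoPOn.exists_regime_tuple (h : IsRecordOfRecord₁₃CCoPOn F N Rg D w) :
    ∃ (θ : Stage13Params F N) (hP : θ.Provisos₁₃Core F N), Rg F θ ∧ θ.Admissible F N ∧ D = datumOfRecord₁₃CoP F N θ hP :=
  h.isDatumOfRecord₁₃CCoPOn

/-- Monotone in the regime. [cite: Balaban1989LargeFieldII, Thm 1 p.355 (bookkeeping)] -/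
theorem IsRecordOfRecord₁₃CCoPOn.mono {Rg' : (F : T4Family) → Stage13Params F N → Prop} (hle : ∀ (F : T4Family) (θ : Stage13Params F N), Rg F θ → Rg' F θ)
    (h : IsRecordOfRecord₁₃CCoPOn F N Rg D w) : IsRecordOfRecord₁₃CCoPOn F N Rg' D w := by
  obtain ⟨θ, hRg, hk⟩ := h
  exact ⟨θ, hle F θ hRg, hk⟩

/-- The world's window is positive. [cite: Balaban1987RG1, Thm 1 p.259 (bookkeeping)] -/
theorem IsRecordOfRecord₁₃CCoPOn.gamma_pos (h : IsRecordOfRecord₁₃CCoPOn F N Rg D w) : 0 < w.γ := by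
  obtain ⟨θ, -, hk⟩ := h
  exact hk.gamma_pos

/-- The world is bound to the datum's construction. [cite: Balaban1989LargeFieldII, Thm 1 + (0.1) pp.355–356 (bookkeeping)] -/
theorem IsRecordOfRecord₁₃CCoPOn.construction_eq (h : IsRecordOfRecord₁₃CCoPOn F N Rg D w) : w.C = D.C := by
  obtain ⟨θ, -, hk⟩ := h
  exact hk.construction_eq

/-- A Stage-13 record keyed at a θ IN THE REGIME is a record in the regime (pointed intro). [cite: Balaban1989LargeFieldII, Thm 1 + (0.1) pp.355–356 (bookkeeping)] -/
theorem IsRateKey₁₃CoP.isRecordOfRecord₁₃CCoPOn {θ : Stage13Params F N} (hk : IsRateKey₁₃CoP F N D w θ) (hRg : Rg F θ) : IsRecordOfRecord₁₃CCoPOn F N Rg D w :=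
  ⟨θ, hRg, hk⟩

/-- At the trivial regime the record key IS `IsRecordOfRecord₁₃CCoP`. [cite: Balaban1989LargeFieldII, Thm 1 p.355 (bookkeeping)] -/
theorem isRecordOfRecord₁₃CCoPOn_true_iff : IsRecordOfRecord₁₃CCoPOn F N (fun _ _ => True) D w ↔ IsRecordOfRecord₁₃CCoP F N D w :=
  ⟨fun h => h.isRecordOfRecord₁₃CCoP, fun ⟨θ, hk⟩ => ⟨θ, trivial, hk⟩⟩

/-- **DATUM OF RECORD IN THE REGIME ⟺ RECORD IN THE REGIME AT SOME WORLD.** [cite: Balaban1989LargeFieldII, Thm 1 + (0.1) pp.355–356 (bookkeeping)] -/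
theorem isDatumOfRecord₁₃CCoPOn_iff_exists_world : IsDatumOfRecord₁₃CCoPOn F N Rg D ↔ ∃ w : WorldP, IsRecordOfRecord₁₃CCoPOn F N Rg D w := by
  constructor
  · rintro ⟨θ, hP, hRg, hθ, rfl⟩
    obtain ⟨w, hw, -⟩ := exists_world_isRecordOfRecord₁₃CCoPOn F N Rg θ hP hRg hθ ⟨hθ.toStage9.gamma_pos, le_rfl⟩
    exact ⟨w, hw⟩
  · rintro ⟨w, hw⟩
    exact hw.isDatumOfRecord₁₃CCoPOn

/-- **WORLD COMPANION IN THE REGIME AT ANY WINDOW BELOW THE CANONICAL ONE** (what an N17-type home-keying binder consumes once the U3 radius is pinned in `]0, h.params.γ]`).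
[cite: Balaban1989LargeFieldII, Thm 1 + (0.1) pp.355–356 (bookkeeping)] -/
theorem IsDatumOfRecord₁₃CCoPOn.exists_world (h : IsDatumOfRecord₁₃CCoPOn F N Rg D) {γw : ℝ} (hγw : 0 < γw ∧ γw ≤ h.params.γ) :
    ∃ w : WorldP, IsRecordOfRecord₁₃CCoPOn F N Rg D w ∧ w.γ = γw := by
  obtain ⟨w, hw, hγ⟩ := exists_world_isRecordOfRecord₁₃CCoPOn F N Rg h.params h.provisos h.regime h.admissible hγw
  exact ⟨w, h.eq_datumOfRecord₁₃CoP ▸ hw, hγ⟩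

/-- … in particular at the canonical window itself. [cite: Balaban1989LargeFieldII, Thm 1 + (0.1) pp.355–356 (bookkeeping)] -/
theorem IsDatumOfRecord₁₃CCoPOn.exists_world_gamma (h : IsDatumOfRecord₁₃CCoPOn F N Rg D) :
    ∃ w : WorldP, IsRecordOfRecord₁₃CCoPOn F N Rg D w ∧ w.γ = h.params.γ :=
  h.exists_world ⟨h.gamma_pos, le_rfl⟩

/-- The ₅C shadow at the canonical parameter in the regime (for consumers keyed at ₅C). [cite: Balaban1989LargeFieldII, Thm 1 + (0.1) pp.355–356 (bookkeeping)] -/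
theorem IsDatumOfRecord₁₃CCoPOn.exists_isRecordOfRecord₅C (h : IsDatumOfRecord₁₃CCoPOn F N Rg D) :
    ∃ (D₅ : FiniteEpsData F (SU N)) (w : WorldP), IsRecordOfRecord₅C F N D₅ w ∧ D₅.C = D.C ∧ (∀ K g₀ k, D₅.dens K g₀ k = D.dens K g₀ k) ∧
      D₅.βfun = D.βfun ∧ D₅.av = D.av :=
  h.toC.exists_isRecordOfRecord₅C

end RecordKeyOn

/-! ## §6. Canonicalised readings RELATIVE TO THE REGIME — coherence for regime homes keyed «`∃ θ hP, Rg F θ ∧ θ.Admissible F N ∧ D = datumOfRecord₁₃CoP F N θ hP ∧ S = cr F θ hP …`»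

As `canon₁₃CoP` (gen 2) for the C key: reading a regime-keyed record through `canon₁₃CoPOn Rg f` makes the admitted bundle a function of the DATUM, read at the canonical parameter IN
THE REGIME, so two regime homes read through `canon₁₃CoPOn Rg` admit, at the same `(F, D, g₀, os)`, bundles read at ONE parameter (`exists_keyed_canon₁₃CoPOn_iff`,
`keyed_canon₁₃CoPOn_coherent`).  Off the class `canon₁₃CoPOn Rg f = f`. -/
section CanonOn

variable (F : T4Family) (N : ℕ) [NeZero N] (Rg : (F : T4Family) → Stage13Params F N → Prop) {α : Sort*}

/-- **CANONICALISED READING RELATIVE TO THE REGIME**: read `f` at the canonical parameter in `Rg` of the datum `datumOfRecord₁₃CoP F N θ hP` when that datum is of record in the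
regime, else at `(θ, hP)` itself.  Kernel bookkeeping (`Classical.dec`, `dite`). [cite: Balaban1989LargeFieldII, Thm 1 + (0.1) pp.355–356 (bookkeeping)] -/
def canon₁₃CoPOn (f : (θ : Stage13Params F N) → θ.Provisos₁₃Core F N → α) (θ : Stage13Params F N) (hP : θ.Provisos₁₃Core F N) : α := by
  classical
  exact if h : IsDatumOfRecord₁₃CCoPOn F N Rg (datumOfRecord₁₃CoP F N θ hP) then f h.params h.provisos else f θ hP

variable {F N Rg}

/-- **`canon₁₃CoPOn Rg f θ hP = f h.params h.provisos`** whenever `(θ, hP)` realises a datum of record in the regime `D` with key `h`. [cite: Balaban1989LargeFieldII, Thm 1 + (0.1) pp.355–356 (bookkeeping)] -/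
theorem canon₁₃CoPOn_eq_of_eq {f : (θ : Stage13Params F N) → θ.Provisos₁₃Core F N → α} {D : FiniteEpsData F (SU N)} (h : IsDatumOfRecord₁₃CCoPOn F N Rg D)
    (θ : Stage13Params F N) (hP : θ.Provisos₁₃Core F N) (e : D = datumOfRecord₁₃CoP F N θ hP) :
    canon₁₃CoPOn F N Rg f θ hP = f h.params h.provisos := by
  subst e
  unfold canon₁₃CoPOn
  rw [dif_pos h]

/-- At the canonical parameter in the regime `canon₁₃CoPOn Rg f` reads `f`. [cite: Balaban1989LargeFieldII, Thm 1 + (0.1) pp.355–356 (bookkeeping)] -/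
theorem canon₁₃CoPOn_params {f : (θ : Stage13Params F N) → θ.Provisos₁₃Core F N → α} {D : FiniteEpsData F (SU N)} (h : IsDatumOfRecord₁₃CCoPOn F N Rg D) :
    canon₁₃CoPOn F N Rg f h.params h.provisos = f h.params h.provisos :=
  canon₁₃CoPOn_eq_of_eq h h.params h.provisos h.eq_datumOfRecord₁₃CoP

/-- At an admissible tuple IN THE REGIME with provisos, `canon₁₃CoPOn Rg f` reads `f` at the canonical parameter in the regime of ITS datum. [cite: Balaban1989LargeFieldII, Thm 1 + (0.1) pp.355–356 (bookkeeping)] -/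
theorem canon₁₃CoPOn_eq_of_regime {f : (θ : Stage13Params F N) → θ.Provisos₁₃Core F N → α} (θ : Stage13Params F N) (hP : θ.Provisos₁₃Core F N) (hRg : Rg F θ)
    (hθ : θ.Admissible F N) :
    canon₁₃CoPOn F N Rg f θ hP = f (isDatumOfRecord₁₃CCoPOn_datumOfRecord₁₃CoP F N Rg θ hP hRg hθ).params (isDatumOfRecord₁₃CCoPOn_datumOfRecord₁₃CoP F N Rg θ hP hRg hθ).provisos :=
  canon₁₃CoPOn_eq_of_eq _ θ hP rfl

/-- Off the class nothing is canonicalised. [cite: Balaban1989LargeFieldII, Thm 1 + (0.1) pp.355–356 (bookkeeping)] -/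
theorem canon₁₃CoPOn_eq_self_of_not {f : (θ : Stage13Params F N) → θ.Provisos₁₃Core F N → α} (θ : Stage13Params F N) (hP : θ.Provisos₁₃Core F N)
    (hn : ¬ IsDatumOfRecord₁₃CCoPOn F N Rg (datumOfRecord₁₃CoP F N θ hP)) : canon₁₃CoPOn F N Rg f θ hP = f θ hP := by
  unfold canon₁₃CoPOn
  rw [dif_neg hn]

/-- **THE KEYED-RECORD FACE, IN THE REGIME**: a regime-keyed record read through `canon₁₃CoPOn Rg f` IS the datum-keyed record «the bundle reads `f` at the canonical parameter in
the regime of `D`», for every property `Φ` of the reading. [cite: Balaban1989LargeFieldII, Thm 1 + (0.1) pp.355–356 (bookkeeping)] -/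
theorem exists_keyed_canon₁₃CoPOn_iff {f : (θ : Stage13Params F N) → θ.Provisos₁₃Core F N → α} {D : FiniteEpsData F (SU N)} (Φ : α → Prop) :
    (∃ (θ : Stage13Params F N) (hP : θ.Provisos₁₃Core F N), Rg F θ ∧ θ.Admissible F N ∧ D = datumOfRecord₁₃CoP F N θ hP ∧ Φ (canon₁₃CoPOn F N Rg f θ hP)) ↔
      ∃ h : IsDatumOfRecord₁₃CCoPOn F N Rg D, Φ (f h.params h.provisos) := by
  constructor
  · rintro ⟨θ, hP, hRg, hθ, e, hΦ⟩
    have h : IsDatumOfRecord₁₃CCoPOn F N Rg D := ⟨θ, hP, hRg, hθ, e⟩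
    refine ⟨h, ?_⟩
    rwa [canon₁₃CoPOn_eq_of_eq (f := f) h θ hP e] at hΦ
  · rintro ⟨h, hΦ⟩
    refine ⟨h.params, h.provisos, h.regime, h.admissible, h.eq_datumOfRecord₁₃CoP, ?_⟩
    rwa [canon₁₃CoPOn_params (f := f) h]

/-- **COHERENCE IN THE REGIME**: two regime-keyed records read through `canon₁₃CoPOn Rg` admit, at the same datum, readings AT THE SAME PARAMETER.
[cite: Balaban1989LargeFieldII, Thm 1 + (0.1) pp.355–356 (bookkeeping)] -/
theorem keyed_canon₁₃CoPOn_coherent {β : Sort*} {f : (θ : Stage13Params F N) → θ.Provisos₁₃Core F N → α} {g : (θ : Stage13Params F N) → θ.Provisos₁₃Core F N → β}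
    {D : FiniteEpsData F (SU N)} (Φ : α → Prop) (Ψ : β → Prop)
    (hΦ : ∃ (θ : Stage13Params F N) (hP : θ.Provisos₁₃Core F N), Rg F θ ∧ θ.Admissible F N ∧ D = datumOfRecord₁₃CoP F N θ hP ∧ Φ (canon₁₃CoPOn F N Rg f θ hP))
    (hΨ : ∃ (θ : Stage13Params F N) (hP : θ.Provisos₁₃Core F N), Rg F θ ∧ θ.Admissible F N ∧ D = datumOfRecord₁₃CoP F N θ hP ∧ Ψ (canon₁₃CoPOn F N Rg g θ hP)) :
    ∃ h : IsDatumOfRecord₁₃CCoPOn F N Rg D, Φ (f h.params h.provisos) ∧ Ψ (g h.params h.provisos) := by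
  obtain ⟨h, h₁⟩ := (exists_keyed_canon₁₃CoPOn_iff Φ).1 hΦ
  obtain ⟨h', h₂⟩ := (exists_keyed_canon₁₃CoPOn_iff Ψ).1 hΨ
  exact ⟨h, h₁, h₂⟩

end CanonOn

/-! ## §7. THE GUARD OF RECORD «partition of unity ∧ non-degenerate present slots» and the CN instances

The route's Stage-13 items (rev 16, to be minted) bundle `θ.ZtUnity F N` (print's partition of unity for the residual 𝐓-weights, [Balaban1988Convergent] (3.16)–(3.20)) and
`θ.SlotsNondegenerate₁₃ F N` (no present slot of record is the zero density, (3.22)) into ONE conjunction on the datum's own parameter.  Named once as a regime; the «CN key» is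
§4–§6 at that regime. -/

section Guard

variable (F : T4Family) (N : ℕ) [NeZero N]


/-- **THE CN KEY — «`D` is a datum of record, Stage 13, realised by an admissible tuple WITH print's partition of unity AND non-degenerate present slots»**: the datum key
at the guard of record. [cite: Balaban1989LargeFieldII, Thm 1 + (0.1) pp.355–356; Balaban1988Convergent, (3.16)–(3.22) pp.268–269 (objects of record; bookkeeping)] -/
abbrev IsDatumOfRecord₁₃CCoPN (D : FiniteEpsData F (SU N)) : Prop :=
  IsDatumOfRecord₁₃CCoPOn F N (unityNondeg₁₃ N) D

/-- **THE CN RECORD CLASS** at the guard of record. [cite: Balaban1989LargeFieldII, Thm 1 + (0.1) pp.355–356; Balaban1988Convergent, (3.16)–(3.22) pp.268–269 (objects of record; bookkeeping)] -/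
abbrev IsRecordOfRecord₁₃CCoPN (D : FiniteEpsData F (SU N)) (w : WorldP) : Prop :=
  IsRecordOfRecord₁₃CCoPOn F N (unityNondeg₁₃ N) D w

/-- **The CN key, literally**: SOME Stage-13 parameter tuple with provisos, `(θ.ZtUnity F N ∧ θ.SlotsNondegenerate₁₃ F N)`, admissible, has `D` as its datum of record (`Iff.rfl`).
[cite: Balaban1989LargeFieldII, Thm 1 + (0.1) pp.355–356; Balaban1988Convergent, (3.16)–(3.22) pp.268–269 (bookkeeping)] -/
theorem isDatumOfRecord₁₃CCoPN_iff (D : FiniteEpsData F (SU N)) :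
    IsDatumOfRecord₁₃CCoPN F N D ↔
      ∃ (θ : Stage13Params F N) (h : θ.Provisos₁₃Core F N), (θ.ZtUnity F N ∧ θ.SlotsNondegenerate₁₃ F N) ∧ θ.Admissible F N ∧ D = datumOfRecord₁₃CoP F N θ h :=
  Iff.rfl

/-- **The CN record class, literally** (`Iff.rfl`). [cite: Balaban1989LargeFieldII, Thm 1 + (0.1) pp.355–356 (bookkeeping)] -/
theorem isRecordOfRecord₁₃CCoPN_iff (D : FiniteEpsData F (SU N)) (w : WorldP) :
    IsRecordOfRecord₁₃CCoPN F N D w ↔ ∃ θ : Stage13Params F N, (θ.ZtUnity F N ∧ θ.SlotsNondegenerate₁₃ F N) ∧ IsRateKey₁₃CoP F N D w θ :=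
  Iff.rfl

/-- Intro at a guarded admissible tuple with provisos. [cite: Balaban1989LargeFieldII, Thm 1 + (0.1) pp.355–356 (bookkeeping)] -/
theorem isDatumOfRecord₁₃CCoPN_datumOfRecord₁₃CoP (θ : Stage13Params F N) (h : θ.Provisos₁₃Core F N) (hG : θ.ZtUnity F N ∧ θ.SlotsNondegenerate₁₃ F N) (hθ : θ.Admissible F N) :
    IsDatumOfRecord₁₃CCoPN F N (datumOfRecord₁₃CoP F N θ h) :=
  isDatumOfRecord₁₃CCoPOn_datumOfRecord₁₃CoP F N _ θ h hG hθ

/-- **K0′ READS THE SAME AT THE CN DATUM**: some CN datum of record exists at `(F, N)` iff SOME Stage-13 parameter tuple satisfies every displayed proviso, print's partition of unity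
and non-degeneracy of the present slots, and is admissible — the body of the route's `Record12Inhabited` (rev 15) at `(F, N)`, verbatim; inhabitation is NOT claimed here.
[cite: Balaban1988Convergent, (2.7) p.255, (2.21) p.258, (2.28) p.259, (3.16)–(3.22) pp.268–269; Balaban1987RG1, (1.12)–(1.15) p.262 (hypothesis dictionary; bookkeeping)] -/
theorem exists_isDatumOfRecord₁₃CCoPN_iff_exists_params :
    (∃ D : FiniteEpsData F (SU N), IsDatumOfRecord₁₃CCoPN F N D) ↔
      ∃ θ : Stage13Params F N, θ.Provisos₁₃Core F N ∧ (θ.ZtUnity F N ∧ θ.SlotsNondegenerate₁₃ F N) ∧ θ.Admissible F N :=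
  exists_isDatumOfRecord₁₃CCoPOn_iff_exists_params F N _

/-- … and iff some CN record exists. [cite: Balaban1989LargeFieldII, Thm 1 + (0.1) pp.355–356 (bookkeeping)] -/
theorem exists_isRecordOfRecord₁₃CCoPN_iff_exists_params :
    (∃ (D : FiniteEpsData F (SU N)) (w : WorldP), IsRecordOfRecord₁₃CCoPN F N D w) ↔
      ∃ θ : Stage13Params F N, θ.Provisos₁₃Core F N ∧ (θ.ZtUnity F N ∧ θ.SlotsNondegenerate₁₃ F N) ∧ θ.Admissible F N :=
  (exists_isDatumOfRecord₁₃CCoPOn_iff_exists_record F N _).symm.trans (exists_isDatumOfRecord₁₃CCoPN_iff_exists_params F N)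

/-- **THE K2′ ∕ K3′ JUNCTION**: a world-blind property at EVERY CN record ⟺ the θ-keyed sentence «`∀ θ (h : θ.Provisos₁₃Core F N), (θ.ZtUnity F N ∧ θ.SlotsNondegenerate₁₃ F N) →
θ.Admissible F N → P (datumOfRecord₁₃CoP F N θ h)`» — the items' binder prefix (what a `Spine` ∕ endpoint composer over the CN record class reads the text off).
[cite: Balaban1989LargeFieldII, Thm 1 + (0.1) pp.355–356 (bookkeeping)] -/
theorem forall_isRecordOfRecord₁₃CCoPN_iff (P : FiniteEpsData F (SU N) → Prop) :
    (∀ (D : FiniteEpsData F (SU N)) (w : WorldP), IsRecordOfRecord₁₃CCoPN F N D w → P D) ↔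
      ∀ (θ : Stage13Params F N) (h : θ.Provisos₁₃Core F N), (θ.ZtUnity F N ∧ θ.SlotsNondegenerate₁₃ F N) → θ.Admissible F N → P (datumOfRecord₁₃CoP F N θ h) :=
  forall_isRecordOfRecord₁₃CCoPOn_iff F N _ P

/-- … datum-level form. [cite: Balaban1989LargeFieldII, Thm 1 + (0.1) pp.355–356 (bookkeeping)] -/
theorem forall_isDatumOfRecord₁₃CCoPN_iff (P : FiniteEpsData F (SU N) → Prop) :
    (∀ D : FiniteEpsData F (SU N), IsDatumOfRecord₁₃CCoPN F N D → P D) ↔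
      ∀ (θ : Stage13Params F N) (h : θ.Provisos₁₃Core F N), (θ.ZtUnity F N ∧ θ.SlotsNondegenerate₁₃ F N) → θ.Admissible F N → P (datumOfRecord₁₃CoP F N θ h) :=
  forall_isDatumOfRecord₁₃CCoPOn_iff F N _ P

/-- Every guarded admissible θ with provisos is a CN record at some world with any window `0 < γw ≤ θ.γ`. [cite: Balaban1989LargeFieldII, Thm 1 + (0.1) pp.355–356 (bookkeeping)] -/
theorem exists_world_isRecordOfRecord₁₃CCoPN (θ : Stage13Params F N) (h : θ.Provisos₁₃Core F N) (hG : θ.ZtUnity F N ∧ θ.SlotsNondegenerate₁₃ F N) (hθ : θ.Admissible F N)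
    {γw : ℝ} (hγw : 0 < γw ∧ γw ≤ θ.γ) : ∃ w : WorldP, IsRecordOfRecord₁₃CCoPN F N (datumOfRecord₁₃CoP F N θ h) w ∧ w.γ = γw :=
  exists_world_isRecordOfRecord₁₃CCoPOn F N _ θ h hG hθ hγw

variable {F N}
variable {D : FiniteEpsData F (SU N)} {w : WorldP}

/-- **THE GUARD AT THE CANONICAL CN PARAMETER** — the one thing the C key cannot supply. [cite: Balaban1988Convergent, (3.16)–(3.22) pp.268–269 (bookkeeping)] -/
theorem IsDatumOfRecord₁₃CCoPN.guard (h : IsDatumOfRecord₁₃CCoPN F N D) : h.params.ZtUnity F N ∧ h.params.SlotsNondegenerate₁₃ F N :=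
  h.regime

/-- Print's partition of unity at the canonical CN parameter. [cite: Balaban1988Convergent, (3.16)–(3.20) pp.268–269 (bookkeeping)] -/
theorem IsDatumOfRecord₁₃CCoPN.ztUnity (h : IsDatumOfRecord₁₃CCoPN F N D) : h.params.ZtUnity F N :=
  h.regime.1

/-- Non-degeneracy of the present slots at the canonical CN parameter. [cite: Balaban1988Convergent, (3.22) p.269 (bookkeeping)] -/
theorem IsDatumOfRecord₁₃CCoPN.slotsNondegenerate (h : IsDatumOfRecord₁₃CCoPN F N D) : h.params.SlotsNondegenerate₁₃ F N :=
  h.regime.2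

/-- **WHAT A CONSUMER PROVES UNDER THE GUARD ⟹ WHAT THE CN INSTANCE CARRIES** (the items' binder order: guard, then admissibility). [cite: Balaban1989LargeFieldII, Thm 1 p.355 (bookkeeping)] -/
theorem IsDatumOfRecord₁₃CCoPN.forall_params {P : (D : FiniteEpsData F (SU N)) → (θ : Stage13Params F N) → θ.Provisos₁₃Core F N → Prop}
    (hP : ∀ (θ : Stage13Params F N) (hθ : θ.Provisos₁₃Core F N), (θ.ZtUnity F N ∧ θ.SlotsNondegenerate₁₃ F N) → θ.Admissible F N → P (datumOfRecord₁₃CoP F N θ hθ) θ hθ)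
    (h : IsDatumOfRecord₁₃CCoPN F N D) : P D h.params h.provisos :=
  IsDatumOfRecord₁₃CCoPOn.forall_params hP h

/-- A CN datum is a C datum (the guard forgotten; its C-canonical parameter is NOT asserted to satisfy the guard). [cite: Balaban1989LargeFieldII, Thm 1 p.355 (bookkeeping)] -/
theorem IsDatumOfRecord₁₃CCoPN.isDatumOfRecord₁₃CCoP (h : IsDatumOfRecord₁₃CCoPN F N D) : IsDatumOfRecord₁₃CCoP F N D :=
  h.toC

/-- A CN record is a Stage-13 record. [cite: Balaban1989LargeFieldII, Thm 1 p.355 (bookkeeping)] -/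
theorem IsRecordOfRecord₁₃CCoPN.isRecordOfRecord₁₃CCoP' (h : IsRecordOfRecord₁₃CCoPN F N D w) : IsRecordOfRecord₁₃CCoP F N D w :=
  h.isRecordOfRecord₁₃CCoP

/-- The guarded tuple behind a CN record (feeds the ₁₃ re-key of `s_R00x_rRec₁₂On_of_regime 𝔯 ·` at `unityNondeg₁₃ N` in one application). [cite: Balaban1989LargeFieldII, Thm 1 + (0.1) pp.355–356 (bookkeeping)] -/
theorem IsRecordOfRecord₁₃CCoPN.exists_guarded_tuple (h : IsRecordOfRecord₁₃CCoPN F N D w) :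
    ∃ (θ : Stage13Params F N) (hP : θ.Provisos₁₃Core F N), (θ.ZtUnity F N ∧ θ.SlotsNondegenerate₁₃ F N) ∧ θ.Admissible F N ∧ D = datumOfRecord₁₃CoP F N θ hP :=
  h.exists_regime_tuple

/-- A datum of record whose C-canonical parameter satisfies the guard is a CN datum. [cite: Balaban1989LargeFieldII, Thm 1 p.355 (bookkeeping)] -/
theorem IsDatumOfRecord₁₃CCoP.isDatumOfRecord₁₃CCoPN_of_guard (h : IsDatumOfRecord₁₃CCoP F N D) (hG : h.params.ZtUnity F N ∧ h.params.SlotsNondegenerate₁₃ F N) :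
    IsDatumOfRecord₁₃CCoPN F N D :=
  h.isDatumOfRecord₁₃CCoPOn_of_regime_params hG

end Guard

end Literature.MathematicalPhysics.QuantumFieldTheory.Balaban1983to89.Node00

end
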